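import Mathlib
import HarnessLib
import Summits.QuantumFields.YangMills.Theses.ConvexGribovBody
import Summits.QuantumFields.YangMills.Theses.SmallCircleAnchor
import Summits.QuantumFields.YangMills.Theses.HyperbolicRegulator
import Summits.QuantumFields.YangMills.Theses.ContractibleFibre
import Summits.QuantumFields.YangMills.Theses.ComplexCouplingChannel
import Summits.QuantumFields.YangMills.Theses.DoublingDefect
import Summits.QuantumFields.YangMills.Theses.NoiseSynchronisation
import Summits.QuantumFields.YangMills.Theses.DirichletWindow
import Summits.QuantumFields.YangMills.Theorems.ComplexCouplingChannelContinuumLegGivenGapSplit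
import Summits.QuantumFields.YangMills.Theorems.ParabolicTrajectoryContinuumLimitOnTrajectoryDefsC
import Summits.QuantumFields.YangMills.Theorems.ComplexCouplingChannelContinuumLegGivenGapAlternatingArraysDefs
import Summits.QuantumFields.YangMills.Theorems.ComplexCouplingChannelContinuumLegGivenGapStubAbstractChessboard
import Summits.QuantumFields.YangMills.Theorems.ComplexCouplingChannelContinuumLegGivenGapStubArrayFunctional
import Literature.Probability.LatticeModels.ChessboardEstimateEvenTorus
import Literature.Probability.LatticeModels.ChessboardEstimateAssignments

/-!
# The linear chessboard estimate for smeared plaquette fields on the odd torus with alternating walls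
(crux `ContinuumLegGivenGap`, stmt-QuantumFields-15828, line `alternating-curvature-arrays`)

`arrays_chessboard` (registered sub-goal; formerly the line's stub `stub_chessboard`): for `0 ≤ β_k`, an admissible level
`3^(m+1) ∣ 2L_k+1`, real `fᵢ` supported in the cores of pairwise distinct level-`m` cells of one translated grid inside the
central half-box and `F = ⊗ᵢ fᵢ`, every array expectation is `≥ 0` and
`‖canonDistribution_k(plaq ∘ q, F)‖ ≤ ∏ᵢ arrayRoot(fᵢ)` (Fröhlich–Israel–Lieb–Simon 1978, Thm 4.1, for these observables).
PROVED from the two landed stubs of the line: the abstract assignment chessboard `stub_abstractChessboard`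
(`…StubAbstractChessboard.lean`; Literature `chessboard_abs_pow_le_prod_const`) and the Wilson reflection-positivity
instance `stub_arrayFunctional` (`…StubArrayFunctional.lean`): the product of constants collapses to `∏ᵢ arrayMean(fᵢ)`
(unit label elsewhere) and the `numCells^4`-th root is taken factorwise.  No definitions. [folklore]
-/

set_option autoImplicit false

noncomputable section

namespace Summit.QuantumFields.YangMills.Theorems.ContinuumLegGivenGap

open scoped SchwartzMap
open Filter Topology MeasureTheory
open Literature.MathematicalPhysics.QuantumFieldTheory Literature.MathematicalPhysics.QuantumLattice
  Literature.MathematicalPhysics.AQFT Literature.Probability.LatticeModels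
open Summit.QuantumFields.YangMills.Theses
open Summit.QuantumFields.YangMills.Cruxes.ContinuumLimitOnTrajectory.TwoOrbitSynchronisation
  (PlaqIdx plaq canonDistribution UUVB PolyVolumeGrowth)
open Summit.QuantumFields.YangMills.Theorems.ContinuumLegGivenGap.AlternatingArrays

/-- `stub_chessboard` — **the LINEAR chessboard estimate on the odd torus with alternating walls** (FILS 1978 Thm 2.2
for the mean-zero smeared plaquette fields, one per occupied cell, on the torus of side `2L_k+1` with
`3^(m+1) ∣ 2L_k+1`): every array expectation is `≥ 0` and `|⟨∏ᵢ Φ(fᵢ)⟩| ≤ ∏ᵢ arrayRoot(fᵢ)` for fields in pairwise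
distinct cells.  DERIVED: the abstract assignment chessboard `stub_abstractChessboard` (p159986; Literature
`chessboard_abs_pow_le_prod_const`, FILS 1978 Thm 4.1) applied to the Wilson array functional of `stub_arrayFunctional` (p161571); the product of constants collapses to `∏ᵢ arrayMean(fᵢ)` (unit label
elsewhere), and the `N^4`-th root is taken factorwise. [folklore] -/
theorem arrays_chessboard :
    ∀ (G : Type) [Group G] [TopologicalSpace G] [IsTopologicalGroup G] [CompactSpace G]
      [MeasurableSpace G] [BorelSpace G] (r : LatticeRep G) (sch : SpeciesScheme (YMSpecies G)) (k m : ℕ),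
      0 ≤ sch.β k → LevelAdmissible (sch.L k) m →
      ∀ (v : Fin 4 → ℤ) (n : ℕ) (q : Fin n → PlaqIdx) (z : Fin n → (Fin 4 → ℤ)) (f : Fin n → 𝓢(EuclideanSpace ℝ (Fin 4), ℝ))
        (F : 𝓢((Fin n → EuclideanSpace ℝ (Fin 4)), ℂ)),
        (∀ i, CellInHalfBox (sch.L k) m v (z i)) → Function.Injective z →
        (∀ i, tsupport (f i) ⊆ physCore (sch.a k) m v (z i)) → IsTensorOf F (fun i => ofRealTest (f i)) →
        (∀ i, 0 ≤ arrayMean r (sch.β k) (sch.a k) (sch.L k) m v (z i) (q i) (f i)) ∧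
          ‖canonDistribution r sch k n (fun i => plaq r (q i)) F‖ ≤
            ∏ i, arrayRoot r (sch.β k) (sch.a k) (sch.L k) m v (z i) (q i) (f i) := by
  intro G _ _ _ _ _ _ r sch k m hβ hm v n q z f F hbox hz hf hF
  classical
  obtain ⟨w, hw, hw0⟩ := numCells_eq_two_mul hm
  haveI : NeZero (numCells (sch.L k) m) := ⟨by omega⟩
  have hNe : Even (numCells (sch.L k) m) := ⟨w, by omega⟩
  obtain ⟨ψ, e, σ₀, hRP, hone, hmean, he, hσe, hσ0, hcanon⟩ :=
    stub_arrayFunctional G r sch k m hβ hm v n q z f F hbox hz hf hF (numCells (sch.L k) m) rfl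
  have hCB := stub_abstractChessboard 4 (numCells (sch.L k) m) (by norm_num) hNe (Option (Fin n)) ψ hRP σ₀
  -- non-negativity of the array means: a constant assignment is its own positive symmetrisation
  have hnn : ∀ i, 0 ≤ arrayMean r (sch.β k) (sch.a k) (sch.L k) m v (z i) (q i) (f i) := fun i => by
    have h := (hRP 0 0 (fun _ => some i)).1
    rwa [asgSymP_const, hmean] at h
  refine ⟨hnn, ?_⟩
  -- the product of constants collapses to the occupied blocks
  have hprod : ∏ c, ψ (fun _ => σ₀ c) = ∏ i, arrayMean r (sch.β k) (sch.a k) (sch.L k) m v (z i) (q i) (f i) := by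
    have himg : ∀ c ∈ (Finset.univ : Finset _), c ∉ Finset.univ.image e → ψ (fun _ => σ₀ c) = 1 :=
      fun c _ hc => by
        rw [hσ0 c fun i h => hc (Finset.mem_image.2 ⟨i, Finset.mem_univ _, h⟩), hone]
    rw [← Finset.prod_subset (Finset.subset_univ (Finset.univ.image e)) himg,
      Finset.prod_image fun i _ j _ h => he h]
    exact Finset.prod_congr rfl fun i _ => by rw [hσe i, hmean i]
  rw [hprod] at hCB
  rw [hcanon]
  have hN0 : (0 : ℝ) < (numCells (sch.L k) m : ℝ) := by exact_mod_cast (show 0 < numCells (sch.L k) m by omega)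
  have hK : (0 : ℝ) < (numCells (sch.L k) m : ℝ) ^ 4 := by positivity
  have hexp : ((numCells (sch.L k) m ^ 4 : ℕ) : ℝ) * ((1 : ℝ) / (numCells (sch.L k) m : ℝ) ^ 4) = 1 := by
    push_cast; exact mul_one_div_cancel hK.ne'
  calc |ψ σ₀| = (|ψ σ₀| ^ (numCells (sch.L k) m ^ 4)) ^ ((1 : ℝ) / (numCells (sch.L k) m : ℝ) ^ 4) := by
        rw [← Real.rpow_natCast, ← Real.rpow_mul (abs_nonneg _), hexp, Real.rpow_one]
    _ ≤ (∏ i, arrayMean r (sch.β k) (sch.a k) (sch.L k) m v (z i) (q i) (f i)) ^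
          ((1 : ℝ) / (numCells (sch.L k) m : ℝ) ^ 4) :=
        Real.rpow_le_rpow (by positivity) hCB (by positivity)
    _ = ∏ i, arrayRoot r (sch.β k) (sch.a k) (sch.L k) m v (z i) (q i) (f i) := by
        rw [← Real.finsetProd_rpow _ _ fun i _ => hnn i]
        rfl

end Summit.QuantumFields.YangMills.Theorems.ContinuumLegGivenGap

end
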